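import Summits.Ventures.CertifiedManyBodySolver.Certificates.HubbardSquare_transportClosure_Kit
import Literature.MathematicalPhysics.QuantumLattice.HubbardTTPrimeChemicalPotentialFloors
import HarnessLib

/-!
# Ventures/CertifiedManyBodySolver — Certificates/HubbardSquare_transportClosure_KitF2.lean
# (hubbard-fast-reuse-5 g4, cell hubbard-fast, D-0154 (A) CERTIFICATE REUSE: the TRANSPORT-CLOSURE kit, part 6b = OFF-AXIS chords,
# `t'`-FACE fans and TRIANGLES; part 6 = `…_KitF.lean` (`U`-face fans, `tc_sheet_monoU`, the full law list and framing))

Joint concavity of `e₀(t, s, U, n)` in `(s, U)` on `U ≥ 0` at fixed filling (`energyDensityTT'_ge_convexComb`,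
`energyDensityTT'_ge_sum_lowerBounds`, [Israel 1979, Thm. I.3.4]) read along OBLIQUE segments, for row sheets whose anchors share
neither `t'` nor `U` with their partners (surrogate-1 `_mlword_Icc` contract, `θ = ![U/t, t'/t, n]`, 8 literal coefficients):
* `tc_mlFloor_fanTa` / `tc_mlFloor_fanTb` — fan from a sheet apex `(s₀, U₀)` to a bilinear floor on a `t'`-FACE `t' = s₁` (the
  `tc_sliceT_floor` shape on `[p, q] × [n₁, n₂]`) above / below the cell; the back-projected coupling
  `U_B = U₀ + (θ0 − U₀)(s₁ − s₀)/(θ1 − s₀)` must lie in `[p, q]` (affine in `(θ0, θ1)`: four + four corner checks); output exactly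
  trilinear, eight vertex checks against a literal form;
* `tc_mlFloor_tri` — triangle of three sheets (positively oriented), barycentric numerators non-negative at the cell's four
  `(θ0, θ1)`-corners (twelve affine checks); output exactly trilinear, eight vertex checks.
HONEST FRAMING: bookkeeping adapters; they certify nothing by themselves; every consumer word inherits exactly the sheet / word
hypotheses it cites (producer-certified CANDIDATE rows until replayed); no number of record; not a phase word; no summit statement
is proved here; not a superconductivity verdict.
-/

namespace Summit.Ventures.CertifiedManyBodySolver.Certificates

open Literature.MathematicalPhysics.QuantumLattice
open Literature.MathematicalPhysics.QuantumLattice.ThermodynamicLimit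
open Set


/-! ### §2 Fans from a sheet apex to a `t'`-face -/

/-- **FAN FLOOR, `t'`-face above the apex** (joint concavity of `e₀` in `(t', U)` along the oblique segment from the sheet anchor
`(s₀, U₀)` through the target point to the face `t' = s₁ > s₀`): a `μ`-floor `(c, μ)` at `(s₀, U₀)` (`U₀ ≥ 0`) and a bilinear floor
`β₀ + β₁U + β₂n + β₃Un ≤ e(t, s₁, U, n)` on `[p, q] × [n₁, n₂]` (`p ≥ 0`) give, on every cell `[Ua, Ub] × [sa, sb] × [n₁, n₂]` with
`s₀ < sa`, `sb ≤ s₁` whose back-projected couplings `U₀ + (θ0 − U₀)(s₁ − s₀)/(θ1 − s₀)` stay in `[p, q]` (corner checks `w`, `w'`),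
`(s₁ − s₀)·e(θ) ≥ (s₁ − θ1)(c + μθ2) + (θ1 − s₀)(β₀ + β₂θ2) + (β₁ + β₃θ2)(U₀(θ1 − s₀) + (θ0 − U₀)(s₁ − s₀))`; eight vertex checks
turn a literal trilinear form below it into a floor on the cell. [cite: Israel1979, Thm. I.3.4] -/
theorem tc_mlFloor_fanTa (t : ℝ) {s₀ U₀ c μ s₁ p q Ua Ub sa sb n₁ n₂ β₀ β₁ β₂ β₃
    c₀ c₁ c₂ c₃ c₄ c₅ c₆ c₇ : ℝ}
    (hc : ∀ m : ℝ, 0 ≤ m → m < 2 → c + μ * m ≤ energyDensityTT' t s₀ U₀ m)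
    (hU₀ : 0 ≤ U₀) (hp : 0 ≤ p) (hsa : s₀ < sa) (hsb : sb ≤ s₁) (hn₁ : 0 ≤ n₁) (hn₂ : n₂ < 2)
    (hB : ∀ U n : ℝ, p ≤ U → U ≤ q → n₁ ≤ n → n ≤ n₂ →
      β₀ + β₁ * U + β₂ * n + β₃ * U * n ≤ energyDensityTT' t s₁ U n)
    (w₁₁ : p * (sa - s₀) ≤ U₀ * (sa - s₀) + (Ua - U₀) * (s₁ - s₀))
    (w₁₁' : U₀ * (sa - s₀) + (Ua - U₀) * (s₁ - s₀) ≤ q * (sa - s₀))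
    (w₁₂ : p * (sb - s₀) ≤ U₀ * (sb - s₀) + (Ua - U₀) * (s₁ - s₀))
    (w₁₂' : U₀ * (sb - s₀) + (Ua - U₀) * (s₁ - s₀) ≤ q * (sb - s₀))
    (w₂₁ : p * (sa - s₀) ≤ U₀ * (sa - s₀) + (Ub - U₀) * (s₁ - s₀))
    (w₂₁' : U₀ * (sa - s₀) + (Ub - U₀) * (s₁ - s₀) ≤ q * (sa - s₀))
    (w₂₂ : p * (sb - s₀) ≤ U₀ * (sb - s₀) + (Ub - U₀) * (s₁ - s₀))
    (w₂₂' : U₀ * (sb - s₀) + (Ub - U₀) * (s₁ - s₀) ≤ q * (sb - s₀))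
    (v₁₁₁ : (c₀ + c₁ * Ua + c₂ * sa + c₃ * n₁ + c₄ * Ua * sa + c₅ * Ua * n₁ + c₆ * sa * n₁ + c₇ * Ua * sa * n₁) * (s₁ - s₀) ≤
      (s₁ - sa) * (c + μ * n₁) + (sa - s₀) * (β₀ + β₂ * n₁) + (β₁ + β₃ * n₁) * (U₀ * (sa - s₀) + (Ua - U₀) * (s₁ - s₀)))
    (v₁₁₂ : (c₀ + c₁ * Ua + c₂ * sa + c₃ * n₂ + c₄ * Ua * sa + c₅ * Ua * n₂ + c₆ * sa * n₂ + c₇ * Ua * sa * n₂) * (s₁ - s₀) ≤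
      (s₁ - sa) * (c + μ * n₂) + (sa - s₀) * (β₀ + β₂ * n₂) + (β₁ + β₃ * n₂) * (U₀ * (sa - s₀) + (Ua - U₀) * (s₁ - s₀)))
    (v₁₂₁ : (c₀ + c₁ * Ua + c₂ * sb + c₃ * n₁ + c₄ * Ua * sb + c₅ * Ua * n₁ + c₆ * sb * n₁ + c₇ * Ua * sb * n₁) * (s₁ - s₀) ≤
      (s₁ - sb) * (c + μ * n₁) + (sb - s₀) * (β₀ + β₂ * n₁) + (β₁ + β₃ * n₁) * (U₀ * (sb - s₀) + (Ua - U₀) * (s₁ - s₀)))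
    (v₁₂₂ : (c₀ + c₁ * Ua + c₂ * sb + c₃ * n₂ + c₄ * Ua * sb + c₅ * Ua * n₂ + c₆ * sb * n₂ + c₇ * Ua * sb * n₂) * (s₁ - s₀) ≤
      (s₁ - sb) * (c + μ * n₂) + (sb - s₀) * (β₀ + β₂ * n₂) + (β₁ + β₃ * n₂) * (U₀ * (sb - s₀) + (Ua - U₀) * (s₁ - s₀)))
    (v₂₁₁ : (c₀ + c₁ * Ub + c₂ * sa + c₃ * n₁ + c₄ * Ub * sa + c₅ * Ub * n₁ + c₆ * sa * n₁ + c₇ * Ub * sa * n₁) * (s₁ - s₀) ≤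
      (s₁ - sa) * (c + μ * n₁) + (sa - s₀) * (β₀ + β₂ * n₁) + (β₁ + β₃ * n₁) * (U₀ * (sa - s₀) + (Ub - U₀) * (s₁ - s₀)))
    (v₂₁₂ : (c₀ + c₁ * Ub + c₂ * sa + c₃ * n₂ + c₄ * Ub * sa + c₅ * Ub * n₂ + c₆ * sa * n₂ + c₇ * Ub * sa * n₂) * (s₁ - s₀) ≤
      (s₁ - sa) * (c + μ * n₂) + (sa - s₀) * (β₀ + β₂ * n₂) + (β₁ + β₃ * n₂) * (U₀ * (sa - s₀) + (Ub - U₀) * (s₁ - s₀)))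
    (v₂₂₁ : (c₀ + c₁ * Ub + c₂ * sb + c₃ * n₁ + c₄ * Ub * sb + c₅ * Ub * n₁ + c₆ * sb * n₁ + c₇ * Ub * sb * n₁) * (s₁ - s₀) ≤
      (s₁ - sb) * (c + μ * n₁) + (sb - s₀) * (β₀ + β₂ * n₁) + (β₁ + β₃ * n₁) * (U₀ * (sb - s₀) + (Ub - U₀) * (s₁ - s₀)))
    (v₂₂₂ : (c₀ + c₁ * Ub + c₂ * sb + c₃ * n₂ + c₄ * Ub * sb + c₅ * Ub * n₂ + c₆ * sb * n₂ + c₇ * Ub * sb * n₂) * (s₁ - s₀) ≤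
      (s₁ - sb) * (c + μ * n₂) + (sb - s₀) * (β₀ + β₂ * n₂) + (β₁ + β₃ * n₂) * (U₀ * (sb - s₀) + (Ub - U₀) * (s₁ - s₀))) :
    ∀ θ ∈ Set.Icc (![Ua, sa, n₁] : Fin 3 → ℝ) ![Ub, sb, n₂],
      c₀ + c₁ * θ 0 + c₂ * θ 1 + c₃ * θ 2 + c₄ * θ 0 * θ 1 + c₅ * θ 0 * θ 2 + c₆ * θ 1 * θ 2 +
        c₇ * θ 0 * θ 1 * θ 2 ≤ energyDensityTT' t (θ 1) (θ 0) (θ 2) := by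
  intro θ hθ
  obtain ⟨⟨k1, k2⟩, ⟨k3, k4⟩, ⟨k5, k6⟩⟩ := mem_Icc_vec3_iff.1 hθ
  have hn0 : 0 ≤ θ 2 := hn₁.trans k5
  have hn2 : θ 2 < 2 := lt_of_le_of_lt k6 hn₂
  have hD : 0 < s₁ - s₀ := by linarith
  have hD0 : s₁ - s₀ ≠ 0 := hD.ne'
  have hd : 0 < θ 1 - s₀ := by linarith
  -- cone membership: the back-projected coupling lies in the face's `U`-range
  have hlo : 0 ≤ (p * s₀ - U₀ * s₁) + (s₁ - s₀) * θ 0 + (U₀ - p) * θ 1 + 0 * θ 0 * θ 1 :=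
    bilinear_nonneg_on_rect k1 k2 k3 k4 (by linear_combination w₁₁) (by linear_combination w₁₂)
      (by linear_combination w₂₁) (by linear_combination w₂₂)
  have hhi : 0 ≤ (U₀ * s₁ - q * s₀) + (-(s₁ - s₀)) * θ 0 + (q - U₀) * θ 1 + 0 * θ 0 * θ 1 :=
    bilinear_nonneg_on_rect k1 k2 k3 k4 (by linear_combination w₁₁') (by linear_combination w₁₂')
      (by linear_combination w₂₁') (by linear_combination w₂₂')
  set UB : ℝ := U₀ + (θ 0 - U₀) * (s₁ - s₀) / (θ 1 - s₀) with hUB_def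
  have hdUB : (θ 1 - s₀) * UB = U₀ * (θ 1 - s₀) + (θ 0 - U₀) * (s₁ - s₀) := by
    rw [hUB_def]; field_simp
  have hUB₁ : p ≤ UB := by
    have h1 : p * (θ 1 - s₀) ≤ UB * (θ 1 - s₀) := by linear_combination hlo - hdUB
    exact le_of_mul_le_mul_right h1 hd
  have hUB₂ : UB ≤ q := by
    have h1 : UB * (θ 1 - s₀) ≤ q * (θ 1 - s₀) := by linear_combination hhi + hdUB
    exact le_of_mul_le_mul_right h1 hd
  have hUB0 : 0 ≤ UB := hp.trans hUB₁
  have hA' := hc (θ 2) hn0 hn2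
  have hB' := hB UB (θ 2) hUB₁ hUB₂ k5 k6
  set a : ℝ := (s₁ - θ 1) / (s₁ - s₀) with ha_def
  set b : ℝ := (θ 1 - s₀) / (s₁ - s₀) with hb_def
  have ha0 : 0 ≤ a := div_nonneg (by linarith) hD.le
  have hb0 : 0 ≤ b := div_nonneg (by linarith) hD.le
  have hDa : (s₁ - s₀) * a = s₁ - θ 1 := by rw [ha_def]; field_simp
  have hDb : (s₁ - s₀) * b = θ 1 - s₀ := by rw [hb_def]; field_simp
  have hab : a + b = 1 := by
    have h1 : (s₁ - s₀) * (a + b) = (s₁ - s₀) * 1 := by rw [mul_add, hDa, hDb]; ring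
    exact mul_left_cancel₀ hD0 h1
  have hcc := energyDensityTT'_ge_convexComb t hn0 hn2 hU₀ hUB0 ha0 hb0 hab hA' hB'
  have es : a * s₀ + b * s₁ = θ 1 := by
    have h1 : (s₁ - s₀) * (a * s₀ + b * s₁) = (s₁ - s₀) * θ 1 := by
      have e1 : (s₁ - s₀) * (a * s₀ + b * s₁) = ((s₁ - s₀) * a) * s₀ + ((s₁ - s₀) * b) * s₁ := by ring
      rw [e1, hDa, hDb]; ring
    exact mul_left_cancel₀ hD0 h1
  have eu : a * U₀ + b * UB = θ 0 := by
    have h1 : (s₁ - s₀) * (a * U₀ + b * UB) = (s₁ - s₀) * θ 0 := by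
      have e1 : (s₁ - s₀) * (a * U₀ + b * UB) = ((s₁ - s₀) * a) * U₀ + ((s₁ - s₀) * b) * UB := by ring
      rw [e1, hDa, hDb]; linear_combination hdUB
    exact mul_left_cancel₀ hD0 h1
  rw [es, eu] at hcc
  have h1 : (s₁ - θ 1) * (c + μ * θ 2) + (θ 1 - s₀) * (β₀ + β₂ * θ 2) + (β₁ + β₃ * θ 2) * (U₀ * (θ 1 - s₀) + (θ 0 - U₀) * (s₁ - s₀)) ≤
      (s₁ - s₀) * energyDensityTT' t (θ 1) (θ 0) (θ 2) := by
    have h2 := mul_le_mul_of_nonneg_left hcc hD.le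
    have e2 : (s₁ - s₀) * (a * (c + μ * θ 2) + b * (β₀ + β₁ * UB + β₂ * θ 2 + β₃ * UB * θ 2)) = ((s₁ - s₀) * a) * (c + μ * θ 2) + ((s₁ - s₀) * b) * (β₀ + β₂ * θ 2) + (β₁ + β₃ * θ 2) * (((s₁ - s₀) * b) * UB) := by ring
    rw [e2, hDa, hDb, hdUB] at h2
    linear_combination h2
  have hv := trilinear_nonneg_on_Icc₃ (a₀ := Ua) (a₁ := sa) (a₂ := n₁) (b₀ := Ub) (b₁ := sb) (b₂ := n₂)
    (c₀ := s₁ * c - s₀ * β₀ - β₁ * U₀ * s₁ - (s₁ - s₀) * c₀) (c₁ := β₁ * (s₁ - s₀) - (s₁ - s₀) * c₁)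
    (c₂ := -c + β₀ + β₁ * U₀ - (s₁ - s₀) * c₂) (c₃ := s₁ * μ - s₀ * β₂ - β₃ * U₀ * s₁ - (s₁ - s₀) * c₃)
    (c₄ := 0 - (s₁ - s₀) * c₄) (c₅ := β₃ * (s₁ - s₀) - (s₁ - s₀) * c₅)
    (c₆ := -μ + β₂ + β₃ * U₀ - (s₁ - s₀) * c₆) (c₇ := 0 - (s₁ - s₀) * c₇)
    (by linear_combination v₁₁₁) (by linear_combination v₁₁₂) (by linear_combination v₁₂₁)
    (by linear_combination v₁₂₂) (by linear_combination v₂₁₁) (by linear_combination v₂₁₂)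
    (by linear_combination v₂₂₁) (by linear_combination v₂₂₂) θ hθ
  have h3 : (s₁ - s₀) * (c₀ + c₁ * θ 0 + c₂ * θ 1 + c₃ * θ 2 + c₄ * θ 0 * θ 1 + c₅ * θ 0 * θ 2 +
      c₆ * θ 1 * θ 2 + c₇ * θ 0 * θ 1 * θ 2) ≤ (s₁ - s₀) * energyDensityTT' t (θ 1) (θ 0) (θ 2) := by
    linear_combination h1 + hv
  exact le_of_mul_le_mul_left h3 hD

/-- **FAN FLOOR, `t'`-face below the apex** (the mirror statement of `tc_mlFloor_fanTa`): a `μ`-floor `(c, μ)` at `(s₀, U₀)`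
(`U₀ ≥ 0`) and a bilinear floor `β₀ + β₁U + β₂n + β₃Un ≤ e(t, s₁, U, n)` on `[p, q] × [n₁, n₂]` (`p ≥ 0`) at a face `t' = s₁ < s₀`
give, on every cell with `s₁ ≤ sa`, `sb < s₀` whose back-projected couplings `U₀ + (θ0 − U₀)(s₀ − s₁)/(s₀ − θ1)` stay in `[p, q]`,
`(s₀ − s₁)·e(θ) ≥ (θ1 − s₁)(c + μθ2) + (s₀ − θ1)(β₀ + β₂θ2) + (β₁ + β₃θ2)(U₀(s₀ − θ1) + (θ0 − U₀)(s₀ − s₁))`; eight vertex checks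
turn a literal trilinear form below it into a floor on the cell. [cite: Israel1979, Thm. I.3.4] -/
theorem tc_mlFloor_fanTb (t : ℝ) {s₀ U₀ c μ s₁ p q Ua Ub sa sb n₁ n₂ β₀ β₁ β₂ β₃
    c₀ c₁ c₂ c₃ c₄ c₅ c₆ c₇ : ℝ}
    (hc : ∀ m : ℝ, 0 ≤ m → m < 2 → c + μ * m ≤ energyDensityTT' t s₀ U₀ m)
    (hU₀ : 0 ≤ U₀) (hp : 0 ≤ p) (hsa : s₁ ≤ sa) (hsb : sb < s₀) (hn₁ : 0 ≤ n₁) (hn₂ : n₂ < 2)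
    (hB : ∀ U n : ℝ, p ≤ U → U ≤ q → n₁ ≤ n → n ≤ n₂ →
      β₀ + β₁ * U + β₂ * n + β₃ * U * n ≤ energyDensityTT' t s₁ U n)
    (w₁₁ : p * (s₀ - sa) ≤ U₀ * (s₀ - sa) + (Ua - U₀) * (s₀ - s₁))
    (w₁₁' : U₀ * (s₀ - sa) + (Ua - U₀) * (s₀ - s₁) ≤ q * (s₀ - sa))
    (w₁₂ : p * (s₀ - sb) ≤ U₀ * (s₀ - sb) + (Ua - U₀) * (s₀ - s₁))
    (w₁₂' : U₀ * (s₀ - sb) + (Ua - U₀) * (s₀ - s₁) ≤ q * (s₀ - sb))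
    (w₂₁ : p * (s₀ - sa) ≤ U₀ * (s₀ - sa) + (Ub - U₀) * (s₀ - s₁))
    (w₂₁' : U₀ * (s₀ - sa) + (Ub - U₀) * (s₀ - s₁) ≤ q * (s₀ - sa))
    (w₂₂ : p * (s₀ - sb) ≤ U₀ * (s₀ - sb) + (Ub - U₀) * (s₀ - s₁))
    (w₂₂' : U₀ * (s₀ - sb) + (Ub - U₀) * (s₀ - s₁) ≤ q * (s₀ - sb))
    (v₁₁₁ : (c₀ + c₁ * Ua + c₂ * sa + c₃ * n₁ + c₄ * Ua * sa + c₅ * Ua * n₁ + c₆ * sa * n₁ + c₇ * Ua * sa * n₁) * (s₀ - s₁) ≤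
      (sa - s₁) * (c + μ * n₁) + (s₀ - sa) * (β₀ + β₂ * n₁) + (β₁ + β₃ * n₁) * (U₀ * (s₀ - sa) + (Ua - U₀) * (s₀ - s₁)))
    (v₁₁₂ : (c₀ + c₁ * Ua + c₂ * sa + c₃ * n₂ + c₄ * Ua * sa + c₅ * Ua * n₂ + c₆ * sa * n₂ + c₇ * Ua * sa * n₂) * (s₀ - s₁) ≤
      (sa - s₁) * (c + μ * n₂) + (s₀ - sa) * (β₀ + β₂ * n₂) + (β₁ + β₃ * n₂) * (U₀ * (s₀ - sa) + (Ua - U₀) * (s₀ - s₁)))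
    (v₁₂₁ : (c₀ + c₁ * Ua + c₂ * sb + c₃ * n₁ + c₄ * Ua * sb + c₅ * Ua * n₁ + c₆ * sb * n₁ + c₇ * Ua * sb * n₁) * (s₀ - s₁) ≤
      (sb - s₁) * (c + μ * n₁) + (s₀ - sb) * (β₀ + β₂ * n₁) + (β₁ + β₃ * n₁) * (U₀ * (s₀ - sb) + (Ua - U₀) * (s₀ - s₁)))
    (v₁₂₂ : (c₀ + c₁ * Ua + c₂ * sb + c₃ * n₂ + c₄ * Ua * sb + c₅ * Ua * n₂ + c₆ * sb * n₂ + c₇ * Ua * sb * n₂) * (s₀ - s₁) ≤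
      (sb - s₁) * (c + μ * n₂) + (s₀ - sb) * (β₀ + β₂ * n₂) + (β₁ + β₃ * n₂) * (U₀ * (s₀ - sb) + (Ua - U₀) * (s₀ - s₁)))
    (v₂₁₁ : (c₀ + c₁ * Ub + c₂ * sa + c₃ * n₁ + c₄ * Ub * sa + c₅ * Ub * n₁ + c₆ * sa * n₁ + c₇ * Ub * sa * n₁) * (s₀ - s₁) ≤
      (sa - s₁) * (c + μ * n₁) + (s₀ - sa) * (β₀ + β₂ * n₁) + (β₁ + β₃ * n₁) * (U₀ * (s₀ - sa) + (Ub - U₀) * (s₀ - s₁)))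
    (v₂₁₂ : (c₀ + c₁ * Ub + c₂ * sa + c₃ * n₂ + c₄ * Ub * sa + c₅ * Ub * n₂ + c₆ * sa * n₂ + c₇ * Ub * sa * n₂) * (s₀ - s₁) ≤
      (sa - s₁) * (c + μ * n₂) + (s₀ - sa) * (β₀ + β₂ * n₂) + (β₁ + β₃ * n₂) * (U₀ * (s₀ - sa) + (Ub - U₀) * (s₀ - s₁)))
    (v₂₂₁ : (c₀ + c₁ * Ub + c₂ * sb + c₃ * n₁ + c₄ * Ub * sb + c₅ * Ub * n₁ + c₆ * sb * n₁ + c₇ * Ub * sb * n₁) * (s₀ - s₁) ≤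
      (sb - s₁) * (c + μ * n₁) + (s₀ - sb) * (β₀ + β₂ * n₁) + (β₁ + β₃ * n₁) * (U₀ * (s₀ - sb) + (Ub - U₀) * (s₀ - s₁)))
    (v₂₂₂ : (c₀ + c₁ * Ub + c₂ * sb + c₃ * n₂ + c₄ * Ub * sb + c₅ * Ub * n₂ + c₆ * sb * n₂ + c₇ * Ub * sb * n₂) * (s₀ - s₁) ≤
      (sb - s₁) * (c + μ * n₂) + (s₀ - sb) * (β₀ + β₂ * n₂) + (β₁ + β₃ * n₂) * (U₀ * (s₀ - sb) + (Ub - U₀) * (s₀ - s₁))) :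
    ∀ θ ∈ Set.Icc (![Ua, sa, n₁] : Fin 3 → ℝ) ![Ub, sb, n₂],
      c₀ + c₁ * θ 0 + c₂ * θ 1 + c₃ * θ 2 + c₄ * θ 0 * θ 1 + c₅ * θ 0 * θ 2 + c₆ * θ 1 * θ 2 +
        c₇ * θ 0 * θ 1 * θ 2 ≤ energyDensityTT' t (θ 1) (θ 0) (θ 2) := by
  intro θ hθ
  obtain ⟨⟨k1, k2⟩, ⟨k3, k4⟩, ⟨k5, k6⟩⟩ := mem_Icc_vec3_iff.1 hθ
  have hn0 : 0 ≤ θ 2 := hn₁.trans k5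
  have hn2 : θ 2 < 2 := lt_of_le_of_lt k6 hn₂
  have hD : 0 < s₀ - s₁ := by linarith
  have hD0 : s₀ - s₁ ≠ 0 := hD.ne'
  have hd : 0 < s₀ - θ 1 := by linarith
  -- cone membership: the back-projected coupling lies in the face's `U`-range
  have hlo : 0 ≤ (U₀ * s₁ - p * s₀) + (s₀ - s₁) * θ 0 + (p - U₀) * θ 1 + 0 * θ 0 * θ 1 :=
    bilinear_nonneg_on_rect k1 k2 k3 k4 (by linear_combination w₁₁) (by linear_combination w₁₂)
      (by linear_combination w₂₁) (by linear_combination w₂₂)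
  have hhi : 0 ≤ (q * s₀ - U₀ * s₁) + (-(s₀ - s₁)) * θ 0 + (U₀ - q) * θ 1 + 0 * θ 0 * θ 1 :=
    bilinear_nonneg_on_rect k1 k2 k3 k4 (by linear_combination w₁₁') (by linear_combination w₁₂')
      (by linear_combination w₂₁') (by linear_combination w₂₂')
  set UB : ℝ := U₀ + (θ 0 - U₀) * (s₀ - s₁) / (s₀ - θ 1) with hUB_def
  have hdUB : (s₀ - θ 1) * UB = U₀ * (s₀ - θ 1) + (θ 0 - U₀) * (s₀ - s₁) := by
    rw [hUB_def]; field_simp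
  have hUB₁ : p ≤ UB := by
    have h1 : p * (s₀ - θ 1) ≤ UB * (s₀ - θ 1) := by linear_combination hlo - hdUB
    exact le_of_mul_le_mul_right h1 hd
  have hUB₂ : UB ≤ q := by
    have h1 : UB * (s₀ - θ 1) ≤ q * (s₀ - θ 1) := by linear_combination hhi + hdUB
    exact le_of_mul_le_mul_right h1 hd
  have hUB0 : 0 ≤ UB := hp.trans hUB₁
  have hA' := hc (θ 2) hn0 hn2
  have hB' := hB UB (θ 2) hUB₁ hUB₂ k5 k6
  set a : ℝ := (θ 1 - s₁) / (s₀ - s₁) with ha_def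
  set b : ℝ := (s₀ - θ 1) / (s₀ - s₁) with hb_def
  have ha0 : 0 ≤ a := div_nonneg (by linarith) hD.le
  have hb0 : 0 ≤ b := div_nonneg (by linarith) hD.le
  have hDa : (s₀ - s₁) * a = θ 1 - s₁ := by rw [ha_def]; field_simp
  have hDb : (s₀ - s₁) * b = s₀ - θ 1 := by rw [hb_def]; field_simp
  have hab : a + b = 1 := by
    have h1 : (s₀ - s₁) * (a + b) = (s₀ - s₁) * 1 := by rw [mul_add, hDa, hDb]; ring
    exact mul_left_cancel₀ hD0 h1
  have hcc := energyDensityTT'_ge_convexComb t hn0 hn2 hU₀ hUB0 ha0 hb0 hab hA' hB'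
  have es : a * s₀ + b * s₁ = θ 1 := by
    have h1 : (s₀ - s₁) * (a * s₀ + b * s₁) = (s₀ - s₁) * θ 1 := by
      have e1 : (s₀ - s₁) * (a * s₀ + b * s₁) = ((s₀ - s₁) * a) * s₀ + ((s₀ - s₁) * b) * s₁ := by ring
      rw [e1, hDa, hDb]; ring
    exact mul_left_cancel₀ hD0 h1
  have eu : a * U₀ + b * UB = θ 0 := by
    have h1 : (s₀ - s₁) * (a * U₀ + b * UB) = (s₀ - s₁) * θ 0 := by
      have e1 : (s₀ - s₁) * (a * U₀ + b * UB) = ((s₀ - s₁) * a) * U₀ + ((s₀ - s₁) * b) * UB := by ring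
      rw [e1, hDa, hDb]; linear_combination hdUB
    exact mul_left_cancel₀ hD0 h1
  rw [es, eu] at hcc
  have h1 : (θ 1 - s₁) * (c + μ * θ 2) + (s₀ - θ 1) * (β₀ + β₂ * θ 2) + (β₁ + β₃ * θ 2) * (U₀ * (s₀ - θ 1) + (θ 0 - U₀) * (s₀ - s₁)) ≤
      (s₀ - s₁) * energyDensityTT' t (θ 1) (θ 0) (θ 2) := by
    have h2 := mul_le_mul_of_nonneg_left hcc hD.le
    have e2 : (s₀ - s₁) * (a * (c + μ * θ 2) + b * (β₀ + β₁ * UB + β₂ * θ 2 + β₃ * UB * θ 2)) = ((s₀ - s₁) * a) * (c + μ * θ 2) + ((s₀ - s₁) * b) * (β₀ + β₂ * θ 2) + (β₁ + β₃ * θ 2) * (((s₀ - s₁) * b) * UB) := by ring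
    rw [e2, hDa, hDb, hdUB] at h2
    linear_combination h2
  have hv := trilinear_nonneg_on_Icc₃ (a₀ := Ua) (a₁ := sa) (a₂ := n₁) (b₀ := Ub) (b₁ := sb) (b₂ := n₂)
    (c₀ := -s₁ * c + s₀ * β₀ + β₁ * U₀ * s₁ - (s₀ - s₁) * c₀) (c₁ := β₁ * (s₀ - s₁) - (s₀ - s₁) * c₁)
    (c₂ := c - β₀ - β₁ * U₀ - (s₀ - s₁) * c₂) (c₃ := -s₁ * μ + s₀ * β₂ + β₃ * U₀ * s₁ - (s₀ - s₁) * c₃)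
    (c₄ := 0 - (s₀ - s₁) * c₄) (c₅ := β₃ * (s₀ - s₁) - (s₀ - s₁) * c₅)
    (c₆ := μ - β₂ - β₃ * U₀ - (s₀ - s₁) * c₆) (c₇ := 0 - (s₀ - s₁) * c₇)
    (by linear_combination v₁₁₁) (by linear_combination v₁₁₂) (by linear_combination v₁₂₁)
    (by linear_combination v₁₂₂) (by linear_combination v₂₁₁) (by linear_combination v₂₁₂)
    (by linear_combination v₂₂₁) (by linear_combination v₂₂₂) θ hθ
  have h3 : (s₀ - s₁) * (c₀ + c₁ * θ 0 + c₂ * θ 1 + c₃ * θ 2 + c₄ * θ 0 * θ 1 + c₅ * θ 0 * θ 2 +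
      c₆ * θ 1 * θ 2 + c₇ * θ 0 * θ 1 * θ 2) ≤ (s₀ - s₁) * energyDensityTT' t (θ 1) (θ 0) (θ 2) := by
    linear_combination h1 + hv
  exact le_of_mul_le_mul_left h3 hD

/-! ### §3 Triangles of three sheets -/

/-- **TRIANGLE FLOOR from three sheets** (barycentric form of the joint concavity of `e₀` in `(t', U)`,
`energyDensityTT'_ge_sum_lowerBounds`): `μ`-floors `(cᵢ, μᵢ)` at anchors `(sᵢ, Uᵢ)`, `Uᵢ ≥ 0`, `i = 1, 2, 3`, positively oriented
(`D = (U₂ − U₁)(s₃ − s₁) − (U₃ − U₁)(s₂ − s₁) > 0`), give on every cell `[Ua, Ub] × [sa, sb] × [n₁, n₂]` (`0 ≤ n₁`, `n₂ < 2`) whose four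
`(θ0, θ1)`-corners have non-negative barycentric numerators `N₁ = (U₂s₃ − U₃s₂) + (s₂ − s₃)θ0 + (U₃ − U₂)θ1`,
`N₂ = (U₃s₁ − U₁s₃) + (s₃ − s₁)θ0 + (U₁ − U₃)θ1`, `N₃ = (U₁s₂ − U₂s₁) + (s₁ − s₂)θ0 + (U₂ − U₁)θ1` (twelve affine checks `p`) the bound
`D·e(θ) ≥ N₁(c₁ + μ₁θ2) + N₂(c₂ + μ₂θ2) + N₃(c₃ + μ₃θ2)` (exactly trilinear); a literal trilinear form below the right-hand side at the
eight vertices is a floor on the cell. [cite: Israel1979, Thm. I.3.4] -/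
theorem tc_mlFloor_tri (t : ℝ) {s₁ U₁ c₁ μ₁ s₂ U₂ c₂ μ₂ s₃ U₃ c₃ μ₃ Ua Ub sa sb n₁ n₂
    d₀ d₁ d₂ d₃ d₄ d₅ d₆ d₇ : ℝ}
    (h₁ : ∀ m : ℝ, 0 ≤ m → m < 2 → c₁ + μ₁ * m ≤ energyDensityTT' t s₁ U₁ m)
    (h₂ : ∀ m : ℝ, 0 ≤ m → m < 2 → c₂ + μ₂ * m ≤ energyDensityTT' t s₂ U₂ m)
    (h₃ : ∀ m : ℝ, 0 ≤ m → m < 2 → c₃ + μ₃ * m ≤ energyDensityTT' t s₃ U₃ m)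
    (hU₁ : 0 ≤ U₁) (hU₂ : 0 ≤ U₂) (hU₃ : 0 ≤ U₃) (hn₁ : 0 ≤ n₁) (hn₂ : n₂ < 2)
    (hD : 0 < ((U₂ - U₁) * (s₃ - s₁) - (U₃ - U₁) * (s₂ - s₁)))
    (p₁₁₁ : 0 ≤ (U₂ * s₃ - U₃ * s₂) + (s₂ - s₃) * Ua + (U₃ - U₂) * sa)
    (p₁₁₂ : 0 ≤ (U₂ * s₃ - U₃ * s₂) + (s₂ - s₃) * Ua + (U₃ - U₂) * sb)
    (p₁₂₁ : 0 ≤ (U₂ * s₃ - U₃ * s₂) + (s₂ - s₃) * Ub + (U₃ - U₂) * sa)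
    (p₁₂₂ : 0 ≤ (U₂ * s₃ - U₃ * s₂) + (s₂ - s₃) * Ub + (U₃ - U₂) * sb)
    (p₂₁₁ : 0 ≤ (U₃ * s₁ - U₁ * s₃) + (s₃ - s₁) * Ua + (U₁ - U₃) * sa)
    (p₂₁₂ : 0 ≤ (U₃ * s₁ - U₁ * s₃) + (s₃ - s₁) * Ua + (U₁ - U₃) * sb)
    (p₂₂₁ : 0 ≤ (U₃ * s₁ - U₁ * s₃) + (s₃ - s₁) * Ub + (U₁ - U₃) * sa)
    (p₂₂₂ : 0 ≤ (U₃ * s₁ - U₁ * s₃) + (s₃ - s₁) * Ub + (U₁ - U₃) * sb)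
    (p₃₁₁ : 0 ≤ (U₁ * s₂ - U₂ * s₁) + (s₁ - s₂) * Ua + (U₂ - U₁) * sa)
    (p₃₁₂ : 0 ≤ (U₁ * s₂ - U₂ * s₁) + (s₁ - s₂) * Ua + (U₂ - U₁) * sb)
    (p₃₂₁ : 0 ≤ (U₁ * s₂ - U₂ * s₁) + (s₁ - s₂) * Ub + (U₂ - U₁) * sa)
    (p₃₂₂ : 0 ≤ (U₁ * s₂ - U₂ * s₁) + (s₁ - s₂) * Ub + (U₂ - U₁) * sb)
    (v₁₁₁ : (d₀ + d₁ * Ua + d₂ * sa + d₃ * n₁ + d₄ * Ua * sa + d₅ * Ua * n₁ + d₆ * sa * n₁ + d₇ * Ua * sa * n₁) *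
        ((U₂ - U₁) * (s₃ - s₁) - (U₃ - U₁) * (s₂ - s₁)) ≤
      ((U₂ * s₃ - U₃ * s₂) + (s₂ - s₃) * Ua + (U₃ - U₂) * sa) * (c₁ + μ₁ * n₁) +
        ((U₃ * s₁ - U₁ * s₃) + (s₃ - s₁) * Ua + (U₁ - U₃) * sa) * (c₂ + μ₂ * n₁) +
        ((U₁ * s₂ - U₂ * s₁) + (s₁ - s₂) * Ua + (U₂ - U₁) * sa) * (c₃ + μ₃ * n₁))
    (v₁₁₂ : (d₀ + d₁ * Ua + d₂ * sa + d₃ * n₂ + d₄ * Ua * sa + d₅ * Ua * n₂ + d₆ * sa * n₂ + d₇ * Ua * sa * n₂) *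
        ((U₂ - U₁) * (s₃ - s₁) - (U₃ - U₁) * (s₂ - s₁)) ≤
      ((U₂ * s₃ - U₃ * s₂) + (s₂ - s₃) * Ua + (U₃ - U₂) * sa) * (c₁ + μ₁ * n₂) +
        ((U₃ * s₁ - U₁ * s₃) + (s₃ - s₁) * Ua + (U₁ - U₃) * sa) * (c₂ + μ₂ * n₂) +
        ((U₁ * s₂ - U₂ * s₁) + (s₁ - s₂) * Ua + (U₂ - U₁) * sa) * (c₃ + μ₃ * n₂))
    (v₁₂₁ : (d₀ + d₁ * Ua + d₂ * sb + d₃ * n₁ + d₄ * Ua * sb + d₅ * Ua * n₁ + d₆ * sb * n₁ + d₇ * Ua * sb * n₁) *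
        ((U₂ - U₁) * (s₃ - s₁) - (U₃ - U₁) * (s₂ - s₁)) ≤
      ((U₂ * s₃ - U₃ * s₂) + (s₂ - s₃) * Ua + (U₃ - U₂) * sb) * (c₁ + μ₁ * n₁) +
        ((U₃ * s₁ - U₁ * s₃) + (s₃ - s₁) * Ua + (U₁ - U₃) * sb) * (c₂ + μ₂ * n₁) +
        ((U₁ * s₂ - U₂ * s₁) + (s₁ - s₂) * Ua + (U₂ - U₁) * sb) * (c₃ + μ₃ * n₁))
    (v₁₂₂ : (d₀ + d₁ * Ua + d₂ * sb + d₃ * n₂ + d₄ * Ua * sb + d₅ * Ua * n₂ + d₆ * sb * n₂ + d₇ * Ua * sb * n₂) *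
        ((U₂ - U₁) * (s₃ - s₁) - (U₃ - U₁) * (s₂ - s₁)) ≤
      ((U₂ * s₃ - U₃ * s₂) + (s₂ - s₃) * Ua + (U₃ - U₂) * sb) * (c₁ + μ₁ * n₂) +
        ((U₃ * s₁ - U₁ * s₃) + (s₃ - s₁) * Ua + (U₁ - U₃) * sb) * (c₂ + μ₂ * n₂) +
        ((U₁ * s₂ - U₂ * s₁) + (s₁ - s₂) * Ua + (U₂ - U₁) * sb) * (c₃ + μ₃ * n₂))
    (v₂₁₁ : (d₀ + d₁ * Ub + d₂ * sa + d₃ * n₁ + d₄ * Ub * sa + d₅ * Ub * n₁ + d₆ * sa * n₁ + d₇ * Ub * sa * n₁) *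
        ((U₂ - U₁) * (s₃ - s₁) - (U₃ - U₁) * (s₂ - s₁)) ≤
      ((U₂ * s₃ - U₃ * s₂) + (s₂ - s₃) * Ub + (U₃ - U₂) * sa) * (c₁ + μ₁ * n₁) +
        ((U₃ * s₁ - U₁ * s₃) + (s₃ - s₁) * Ub + (U₁ - U₃) * sa) * (c₂ + μ₂ * n₁) +
        ((U₁ * s₂ - U₂ * s₁) + (s₁ - s₂) * Ub + (U₂ - U₁) * sa) * (c₃ + μ₃ * n₁))
    (v₂₁₂ : (d₀ + d₁ * Ub + d₂ * sa + d₃ * n₂ + d₄ * Ub * sa + d₅ * Ub * n₂ + d₆ * sa * n₂ + d₇ * Ub * sa * n₂) *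
        ((U₂ - U₁) * (s₃ - s₁) - (U₃ - U₁) * (s₂ - s₁)) ≤
      ((U₂ * s₃ - U₃ * s₂) + (s₂ - s₃) * Ub + (U₃ - U₂) * sa) * (c₁ + μ₁ * n₂) +
        ((U₃ * s₁ - U₁ * s₃) + (s₃ - s₁) * Ub + (U₁ - U₃) * sa) * (c₂ + μ₂ * n₂) +
        ((U₁ * s₂ - U₂ * s₁) + (s₁ - s₂) * Ub + (U₂ - U₁) * sa) * (c₃ + μ₃ * n₂))
    (v₂₂₁ : (d₀ + d₁ * Ub + d₂ * sb + d₃ * n₁ + d₄ * Ub * sb + d₅ * Ub * n₁ + d₆ * sb * n₁ + d₇ * Ub * sb * n₁) *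
        ((U₂ - U₁) * (s₃ - s₁) - (U₃ - U₁) * (s₂ - s₁)) ≤
      ((U₂ * s₃ - U₃ * s₂) + (s₂ - s₃) * Ub + (U₃ - U₂) * sb) * (c₁ + μ₁ * n₁) +
        ((U₃ * s₁ - U₁ * s₃) + (s₃ - s₁) * Ub + (U₁ - U₃) * sb) * (c₂ + μ₂ * n₁) +
        ((U₁ * s₂ - U₂ * s₁) + (s₁ - s₂) * Ub + (U₂ - U₁) * sb) * (c₃ + μ₃ * n₁))
    (v₂₂₂ : (d₀ + d₁ * Ub + d₂ * sb + d₃ * n₂ + d₄ * Ub * sb + d₅ * Ub * n₂ + d₆ * sb * n₂ + d₇ * Ub * sb * n₂) *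
        ((U₂ - U₁) * (s₃ - s₁) - (U₃ - U₁) * (s₂ - s₁)) ≤
      ((U₂ * s₃ - U₃ * s₂) + (s₂ - s₃) * Ub + (U₃ - U₂) * sb) * (c₁ + μ₁ * n₂) +
        ((U₃ * s₁ - U₁ * s₃) + (s₃ - s₁) * Ub + (U₁ - U₃) * sb) * (c₂ + μ₂ * n₂) +
        ((U₁ * s₂ - U₂ * s₁) + (s₁ - s₂) * Ub + (U₂ - U₁) * sb) * (c₃ + μ₃ * n₂)) :
    ∀ θ ∈ Set.Icc (![Ua, sa, n₁] : Fin 3 → ℝ) ![Ub, sb, n₂],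
      d₀ + d₁ * θ 0 + d₂ * θ 1 + d₃ * θ 2 + d₄ * θ 0 * θ 1 + d₅ * θ 0 * θ 2 + d₆ * θ 1 * θ 2 +
        d₇ * θ 0 * θ 1 * θ 2 ≤ energyDensityTT' t (θ 1) (θ 0) (θ 2) := by
  intro θ hθ
  obtain ⟨⟨k1, k2⟩, ⟨k3, k4⟩, ⟨k5, k6⟩⟩ := mem_Icc_vec3_iff.1 hθ
  have hn0 : 0 ≤ θ 2 := hn₁.trans k5
  have hn2 : θ 2 < 2 := lt_of_le_of_lt k6 hn₂
  have hD0 : ((U₂ - U₁) * (s₃ - s₁) - (U₃ - U₁) * (s₂ - s₁)) ≠ 0 := hD.ne'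
  -- barycentric numerators are non-negative on the cell (affine in `(θ0, θ1)`: four corners each)
  have hN₁ : 0 ≤ (U₂ * s₃ - U₃ * s₂) + (s₂ - s₃) * θ 0 + (U₃ - U₂) * θ 1 + 0 * θ 0 * θ 1 :=
    bilinear_nonneg_on_rect k1 k2 k3 k4 (by linear_combination p₁₁₁) (by linear_combination p₁₁₂)
      (by linear_combination p₁₂₁) (by linear_combination p₁₂₂)
  have hN₂ : 0 ≤ (U₃ * s₁ - U₁ * s₃) + (s₃ - s₁) * θ 0 + (U₁ - U₃) * θ 1 + 0 * θ 0 * θ 1 :=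
    bilinear_nonneg_on_rect k1 k2 k3 k4 (by linear_combination p₂₁₁) (by linear_combination p₂₁₂)
      (by linear_combination p₂₂₁) (by linear_combination p₂₂₂)
  have hN₃ : 0 ≤ (U₁ * s₂ - U₂ * s₁) + (s₁ - s₂) * θ 0 + (U₂ - U₁) * θ 1 + 0 * θ 0 * θ 1 :=
    bilinear_nonneg_on_rect k1 k2 k3 k4 (by linear_combination p₃₁₁) (by linear_combination p₃₁₂)
      (by linear_combination p₃₂₁) (by linear_combination p₃₂₂)
  set D : ℝ := ((U₂ - U₁) * (s₃ - s₁) - (U₃ - U₁) * (s₂ - s₁)) with hD_def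
  set M₁ : ℝ := (U₂ * s₃ - U₃ * s₂) + (s₂ - s₃) * θ 0 + (U₃ - U₂) * θ 1 with hM₁
  set M₂ : ℝ := (U₃ * s₁ - U₁ * s₃) + (s₃ - s₁) * θ 0 + (U₁ - U₃) * θ 1 with hM₂
  set M₃ : ℝ := (U₁ * s₂ - U₂ * s₁) + (s₁ - s₂) * θ 0 + (U₂ - U₁) * θ 1 with hM₃
  have hM₁0 : 0 ≤ M₁ := by rw [hM₁]; linear_combination hN₁
  have hM₂0 : 0 ≤ M₂ := by rw [hM₂]; linear_combination hN₂
  have hM₃0 : 0 ≤ M₃ := by rw [hM₃]; linear_combination hN₃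
  have hsum : M₁ + M₂ + M₃ = D := by rw [hM₁, hM₂, hM₃, hD_def]; ring
  have hsumS : M₁ * s₁ + M₂ * s₂ + M₃ * s₃ = D * θ 1 := by rw [hM₁, hM₂, hM₃, hD_def]; ring
  have hsumU : M₁ * U₁ + M₂ * U₂ + M₃ * U₃ = D * θ 0 := by rw [hM₁, hM₂, hM₃, hD_def]; ring
  have hw := energyDensityTT'_ge_sum_lowerBounds t hn0 hn2 (Finset.univ : Finset (Fin 3))
    (![M₁ / D, M₂ / D, M₃ / D]) (![s₁, s₂, s₃]) (![U₁, U₂, U₃])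
    (![c₁ + μ₁ * θ 2, c₂ + μ₂ * θ 2, c₃ + μ₃ * θ 2])
    (by intro i _; fin_cases i <;> simp <;> positivity)
    (by simp [Fin.sum_univ_three]; field_simp; linear_combination hsum)
    (by intro i _; fin_cases i <;> simp <;> assumption)
    (by intro i _; fin_cases i <;> simp <;> [exact h₁ (θ 2) hn0 hn2; exact h₂ (θ 2) hn0 hn2; exact h₃ (θ 2) hn0 hn2])
  simp only [Fin.sum_univ_three, Matrix.cons_val_zero, Matrix.cons_val_one, Matrix.cons_val] at hw
  have es : M₁ / D * s₁ + M₂ / D * s₂ + M₃ / D * s₃ = θ 1 := by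
    field_simp; linear_combination hsumS
  have eu : M₁ / D * U₁ + M₂ / D * U₂ + M₃ / D * U₃ = θ 0 := by
    field_simp; linear_combination hsumU
  rw [es, eu] at hw
  have h1 : M₁ * (c₁ + μ₁ * θ 2) + M₂ * (c₂ + μ₂ * θ 2) + M₃ * (c₃ + μ₃ * θ 2) ≤
      D * energyDensityTT' t (θ 1) (θ 0) (θ 2) := by
    have h2 := mul_le_mul_of_nonneg_left hw hD.le
    have e2 : D * (M₁ / D * (c₁ + μ₁ * θ 2) + M₂ / D * (c₂ + μ₂ * θ 2) + M₃ / D * (c₃ + μ₃ * θ 2)) =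
        M₁ * (c₁ + μ₁ * θ 2) + M₂ * (c₂ + μ₂ * θ 2) + M₃ * (c₃ + μ₃ * θ 2) := by
      field_simp
    rw [e2] at h2
    exact h2
  rw [hM₁, hM₂, hM₃] at h1
  have hv := trilinear_nonneg_on_Icc₃ (a₀ := Ua) (a₁ := sa) (a₂ := n₁) (b₀ := Ub) (b₁ := sb) (b₂ := n₂)
    (c₀ := (U₂ * s₃ - U₃ * s₂) * c₁ +
        (U₃ * s₁ - U₁ * s₃) * c₂ +
        (U₁ * s₂ - U₂ * s₁) * c₃ - ((U₂ - U₁) * (s₃ - s₁) - (U₃ - U₁) * (s₂ - s₁)) * d₀)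
    (c₁ := (s₂ - s₃) * c₁ +
        (s₃ - s₁) * c₂ +
        (s₁ - s₂) * c₃ - ((U₂ - U₁) * (s₃ - s₁) - (U₃ - U₁) * (s₂ - s₁)) * d₁)
    (c₂ := (U₃ - U₂) * c₁ +
        (U₁ - U₃) * c₂ +
        (U₂ - U₁) * c₃ - ((U₂ - U₁) * (s₃ - s₁) - (U₃ - U₁) * (s₂ - s₁)) * d₂)
    (c₃ := (U₂ * s₃ - U₃ * s₂) * μ₁ +
        (U₃ * s₁ - U₁ * s₃) * μ₂ +
        (U₁ * s₂ - U₂ * s₁) * μ₃ - ((U₂ - U₁) * (s₃ - s₁) - (U₃ - U₁) * (s₂ - s₁)) * d₃)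
    (c₄ := 0 - ((U₂ - U₁) * (s₃ - s₁) - (U₃ - U₁) * (s₂ - s₁)) * d₄)
    (c₅ := (s₂ - s₃) * μ₁ +
        (s₃ - s₁) * μ₂ +
        (s₁ - s₂) * μ₃ - ((U₂ - U₁) * (s₃ - s₁) - (U₃ - U₁) * (s₂ - s₁)) * d₅)
    (c₆ := (U₃ - U₂) * μ₁ +
        (U₁ - U₃) * μ₂ +
        (U₂ - U₁) * μ₃ - ((U₂ - U₁) * (s₃ - s₁) - (U₃ - U₁) * (s₂ - s₁)) * d₆)
    (c₇ := 0 - ((U₂ - U₁) * (s₃ - s₁) - (U₃ - U₁) * (s₂ - s₁)) * d₇)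
    (by linear_combination v₁₁₁) (by linear_combination v₁₁₂) (by linear_combination v₁₂₁)
    (by linear_combination v₁₂₂) (by linear_combination v₂₁₁) (by linear_combination v₂₁₂)
    (by linear_combination v₂₂₁) (by linear_combination v₂₂₂) θ hθ
  have h3 : D * (d₀ + d₁ * θ 0 + d₂ * θ 1 + d₃ * θ 2 + d₄ * θ 0 * θ 1 + d₅ * θ 0 * θ 2 +
      d₆ * θ 1 * θ 2 + d₇ * θ 0 * θ 1 * θ 2) ≤ D * energyDensityTT' t (θ 1) (θ 0) (θ 2) := by
    rw [hD_def]; linear_combination h1 + hv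
  exact le_of_mul_le_mul_left h3 hD

end Summit.Ventures.CertifiedManyBodySolver.Certificates
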